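import Literature.Geometry.Riemannian.ShrinkerEntropyProofs
import Literature.Geometry.Riemannian.GradientEstimateIntegration
import Literature.Geometry.Riemannian.LipschitzSmoothing
import Literature.Geometry.Riemannian.RiemannianDistance
import Literature.Geometry.Riemannian.CanonicalNeighbourhoods
import HarnessLib

/-!
# Stub `stub_pathHarnack` of line `gv-continuity-path` (crux `EntropyRung.ChangGurskyYang`)

The "Harnack step" of the a-priori estimates of the Gursky–Viaclovsky continuity method
(Gursky–Viaclovsky 2003, arXiv:math/0301350, proof of Prop. 4, p. 6: "The assumption
`|∇u_t| < C₁` implies the Harnack inequality `max u_t ≤ min u_t + C(C₁, g)`, by simply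
integrating along a geodesic connecting points at which `u_t` attains its maximum and
minimum."), as pure Riemannian geometry: on a compact connected Riemannian `4`-manifold
`(M, g)` a smooth `u` with `|∇u|²_g ≤ C₁` has oscillation at most `√C₁ · diam_g(M)`.

Proof: Cauchy–Schwarz `|du(v)| ≤ |∇u|_g |v|_g ≤ √C₁ |v|_g`
(`abs_mvfderiv_le_sqrt_gradSq_mul_sqrt`), hence `u` is `√C₁`-Lipschitz for the Riemannian
distance (`ofReal_abs_sub_le_mul_riemEDist`), which is finite on a connected manifold
(`riemEDist_lt_top`) and continuous (`continuous_edist`), hence bounded on the compact `M × M`.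
-/

noncomputable section
open scoped Manifold ContDiff Topology ENNReal NNReal
open Set Filter
open Literature.Geometry.Lorentzian (PseudoRiemannianMetric)
open Literature.Geometry.Lorentzian.PseudoRiemannianMetric
open Literature.Geometry.Riemannian

namespace Summit.SmoothPoincare4.SmoothPoincare4.Theorems.GvContinuityPath
set_option linter.dupNamespace false

/-- **Finite diameter of a compact connected Riemannian manifold**: there is `D < ∞` with
`d_g(x, y) ≤ D` for all `x, y` (the distance is continuous on the compact `M × M`, and finite
on a connected manifold). [folklore] -/
theorem exists_riemEDist_le_of_compact
    {n : ℕ} {M : Type*} [TopologicalSpace M] [T2Space M]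
    [ChartedSpace (EuclideanSpace ℝ (Fin n)) M] [IsManifold (𝓡 n) ∞ M] [CompactSpace M]
    [ConnectedSpace M]
    {g : PseudoRiemannianMetric (𝓡 n) ∞ (EuclideanSpace ℝ (Fin n))
      (TangentSpace (𝓡 n) : M → Type _)} (hg : g.IsRiemannian) :
    ∃ D : ℝ≥0∞, D < ⊤ ∧ ∀ x y : M, g.riemEDist x y ≤ D := by
  have hcont : Continuous fun p : M × M ↦ g.edist hg p.1 p.2 :=
    PseudoRiemannianMetric.continuous_edist hg
  obtain ⟨p₀, -, hp₀⟩ := isCompact_univ.exists_isMaxOn univ_nonempty hcont.continuousOn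
  refine ⟨g.edist hg p₀.1 p₀.2, ?_, fun x y ↦ ?_⟩
  · rw [← PseudoRiemannianMetric.riemEDist_eq hg]
    exact CarrilloNi2009_shrinkerLSI.riemEDist_lt_top hg _ _
  · rw [PseudoRiemannianMetric.riemEDist_eq hg]
    exact hp₀ (mem_univ (x, y))

/-- **The Harnack step of Gursky–Viaclovsky's a-priori estimates** (2003, proof of Prop. 4,
p. 6: "The assumption `|∇u_t| < C₁` implies the Harnack inequality
`max u_t ≤ min u_t + C(C₁, g)`, by simply integrating along a geodesic connecting points at
which `u_t` attains its maximum and minimum."): on a compact connected Riemannian `4`-manifold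
`(M, g)`, for every `C₁` there is `C₂ = C₂(M, g, C₁)` (namely `√C₁ · diam_g M`) such that every
smooth `u` with `|∇u|²_g ≤ C₁` satisfies `u(x) ≤ u(y) + C₂` for all `x, y`.
[cite: GurskyViaclovsky2003, proof of Prop. 4, (Harnack)] -/
theorem stub_pathHarnack :
    ∀ (M : Type) [TopologicalSpace M] [T2Space M] [SecondCountableTopology M]
      [ChartedSpace (EuclideanSpace ℝ (Fin 4)) M] [IsManifold (𝓡 4) ∞ M] [CompactSpace M]
      [ConnectedSpace M]
      (g : PseudoRiemannianMetric (𝓡 4) ∞ (EuclideanSpace ℝ (Fin 4)) (TangentSpace (𝓡 4) : M → Type _)),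
      g.IsRiemannian → ∀ C₁ : ℝ, ∃ C₂ : ℝ, ∀ u : M → ℝ, ContMDiff (𝓡 4) 𝓘(ℝ) ∞ u →
        (∀ x, g.gradSq u x ≤ C₁) → ∀ x y, u x ≤ u y + C₂ := by
  intro M _ _ _ _ _ _ _ g hg C₁
  obtain ⟨D, hDlt, hle⟩ := exists_riemEDist_le_of_compact hg
  refine ⟨Real.sqrt C₁ * D.toReal, fun u hu hgrad x y ↦ ?_⟩
  set L : ℝ≥0 := ⟨Real.sqrt C₁, Real.sqrt_nonneg _⟩
  have hLd : ∀ z ∈ (univ : Set M), ∀ v : TangentSpace (𝓡 4) z,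
      |mvfderiv (𝓡 4) u z v| ≤ L * Real.sqrt (g.val z v v) := fun z _ v ↦
    (abs_mvfderiv_le_sqrt_gradSq_mul_sqrt g hg u z v).trans
      (mul_le_mul_of_nonneg_right (Real.sqrt_le_sqrt (hgrad z)) (Real.sqrt_nonneg _))
  have hball : y ∈ g.ball x ⊤ := by
    rw [PseudoRiemannianMetric.mem_ball]
    exact (hle x y).trans_lt hDlt
  have h1 := ofReal_abs_sub_le_mul_riemEDist g hg isOpen_univ
    (hu.of_le (by exact_mod_cast le_top)).contMDiffOn hLd (x := x) (ρ := ⊤) (subset_univ _) hball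
  have h2 : ENNReal.ofReal |u x - u y| ≤ L * D := h1.trans (by gcongr; exact hle x y)
  have h3 := ENNReal.toReal_mono (ENNReal.mul_ne_top ENNReal.coe_ne_top hDlt.ne) h2
  rw [ENNReal.toReal_ofReal (abs_nonneg _), ENNReal.toReal_mul, ENNReal.coe_toReal] at h3
  have h4 : u x - u y ≤ Real.sqrt C₁ * D.toReal := (le_abs_self _).trans h3
  linarith

end Summit.SmoothPoincare4.SmoothPoincare4.Theorems.GvContinuityPath
end
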